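import Summits.Ventures.PercRepro.Night2FatXStructure

/-!
# night-2: the thin faces of a target are thin faces of the basis

For a target `T ⊇ Q = insert z B` of a basis pair, a thin face `T.erase w` (`faceOk T w`) is a face at a point
`w ∈ Q ∖ K`, the face `Q.erase w` of the basis is thin as well (`faceOk_base_of_faceOk`), both have the same closure
(hence the same request), and `w` is a coloop of `T ∖ K`.  So `L1 T` is the sum of the BASE requests
`req (Q.erase w)` over the points `w ∈ Q ∖ K` whose face of `T` is thin (`L1_eq_sum_base_req`), and is bounded by
the sum over the thin faces of `Q` at the coloops of `T ∖ K` (`L1_le_sum_base_req_coloops`):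
`L1 T = Σ_{w ∈ C_eff(T)} r_w` in the notation of `proofs/NIGHT-2-g32.md` §2.2.
-/

namespace PercRepro.Shadow

open PercRepro.ThmH PercRepro.PerFlat

variable {α : Type*} [DecidableEq α] {M : Matroid α} [M.Finite] {G : Finset α}

/-- **A thin face of a target is a thin face of the basis**: `faceOk T w` gives `w ∈ Q`, `faceOk Q w` and
`clF (T.erase w) = clF (Q.erase w)`. -/
theorem faceOk_base_of_faceOk (hG : G ∈ flatsQ M (5 + 1)) (hd : (gr M \ G).card = 2) (hk : kColoops M G = 1)
    {B : Finset α} (hB : B ∈ thinMembers M 5 G) {z : α} (hz : z ∈ G \ clF M B) {T : Finset α}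
    (hT : T ∈ tgtSets M 5 G B z) {w : α} (hw : w ∈ T \ coloops M G) (hok : faceOk M G T w) :
    w ∈ insert z B ∧ faceOk M G (insert z B) w ∧ clF M (T.erase w) = clF M ((insert z B).erase w) := by
  obtain ⟨hthin, hwcl⟩ := hok
  have hd' : (gr M \ G).card ≤ 5 := by omega
  have hGg : G ⊆ gr M := (mem_flatsQ.1 hG).1
  have hTG : T ⊆ G := subset_G_of_mem_shadowAt (mem_tgtSets.1 hT).1
  have hQT : insert z B ⊆ T := (mem_tgtSets.1 hT).2.1
  have hQG : insert z B ⊆ G := hQT.trans hTG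
  have hKQ : coloops M G ⊆ insert z B :=
    (coloops_subset_of_mem_thinMembers hG hd' hB).trans (Finset.subset_insert _ _)
  have hQ6 := rkN_insert_eq_six_of_thin hG hB hz
  have h5 := rkN_eq_five_of_mem_thinMembers hthin
  rw [Finset.mem_sdiff] at hw
  -- `w ∈ Q`
  have hwQ : w ∈ insert z B := by
    by_contra hwQ
    have hsub : insert z B ⊆ T.erase w := by
      intro e he
      rw [Finset.mem_erase]
      exact ⟨fun h => hwQ (h ▸ he), hQT he⟩
    have := rkN_mono (M := M) hsub
    omega
  have hsub : (insert z B).erase w ⊆ T.erase w := Finset.erase_subset_erase _ hQT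
  have hQeg : (insert z B).erase w ⊆ gr M := (Finset.erase_subset _ _).trans (hQG.trans hGg)
  have hTeg : T.erase w ⊆ gr M := (Finset.erase_subset _ _).trans (hTG.trans hGg)
  -- `rk (Q.erase w) = 5`
  have hr5 : rkN M ((insert z B).erase w) = 5 := by
    have h1 := rkN_erase_ge (M := M) (insert z B) w
    have h2 := rkN_mono (M := M) hsub
    omega
  have hcl : clF M ((insert z B).erase w) = clF M (T.erase w) := by
    apply clF_eq_clF_of_subset_clF_of_rkN_le hTeg (hsub.trans (subset_clF_of_subset_gr hTeg))
    omega
  refine ⟨hwQ, ⟨?_, ?_⟩, hcl.symm⟩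
  · -- `Q.erase w` is a thin member
    rw [mem_thinMembers, mem_membersIn, mem_Uq]
    have hKQe : coloops M G ⊆ (insert z B).erase w := by
      intro e he
      rw [Finset.mem_erase]
      exact ⟨fun h => hw.2 (h ▸ he), hKQ he⟩
    refine ⟨⟨⟨hQeg, ?_, ?_⟩, ?_⟩, ?_⟩
    · rw [eRk_eq_rkN, hr5]
    · -- `rk (gr ∖ Q.erase w) = 7`: `≥` from `gr ∖ T.erase w ⊆ gr ∖ Q.erase w`, `≤` from `G ∖ Q.erase w ⊆ G ∖ K`
      rw [eRk_eq_rkN]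
      have h7 := rkN_sdiff_eq_of_mem_Uq (mem_membersIn.1 (mem_thinMembers.1 hthin).1).1
      have hge : rkN M (gr M \ T.erase w) ≤ rkN M (gr M \ (insert z B).erase w) :=
        rkN_mono (Finset.sdiff_subset_sdiff (Finset.Subset.refl _) hsub)
      have hle : rkN M (gr M \ (insert z B).erase w) ≤ 7 := by
        have hsub2 : gr M \ (insert z B).erase w ⊆ (G \ coloops M G) ∪ (gr M \ G) := by
          intro e he
          rw [Finset.mem_sdiff] at he
          rw [Finset.mem_union, Finset.mem_sdiff, Finset.mem_sdiff]
          by_cases heG : e ∈ G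
          · exact Or.inl ⟨heG, fun h => he.2 (hKQe h)⟩
          · exact Or.inr ⟨he.1, heG⟩
        have h1 := rkN_mono (M := M) hsub2
        have h2 := rkN_union_le_add_card (M := M) (G \ coloops M G) (gr M \ G)
        rw [hd, rkN_sdiff_coloops_eq_five hG hk] at h2
        omega
      have : rkN M (gr M \ (insert z B).erase w) = 7 := by omega
      rw [this]
    · exact clF_subset_of_subset_flatsQ hG ((Finset.erase_subset _ _).trans hQG)
    · -- not layer 0: `G ∖ clF (Q.erase w) ⊇ G ∖ clF (T.erase w)` has `≥ 2` points
      intro hlay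
      have h2 := two_le_card_sdiff_of_not_lay0 hG hd' (mem_thinMembers.1 hthin).1 (mem_thinMembers.1 hthin).2
      have h1 := (mem_lay0.1 hlay).2.1
      rw [hcl] at h1
      omega
  · rw [Finset.mem_sdiff] at hwcl ⊢
    rw [hcl]
    exact hwcl

/-- A thin face of a target is at a coloop of `T ∖ K`. -/
theorem mem_coloops_sdiff_of_faceOk (hG : G ∈ flatsQ M (5 + 1)) {T : Finset α} (hTG : T ⊆ G)
    (hT6 : rkN M T = 6) {w : α} (hw : w ∈ T \ coloops M G) (hok : faceOk M G T w) :
    w ∈ coloops M (T \ coloops M G) := by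
  obtain ⟨hthin, -⟩ := hok
  have h5 := rkN_eq_five_of_mem_thinMembers hthin
  rw [mem_coloops]
  refine ⟨hw, fun hcl => ?_⟩
  -- `w ∈ clF ((T ∖ K).erase w) ⊆ clF (T.erase w)` would give `rk T = rk (T.erase w) = 5`
  have hsub : (T \ coloops M G).erase w ⊆ T.erase w :=
    Finset.erase_subset_erase _ Finset.sdiff_subset
  have hwcl : w ∈ clF M (T.erase w) := clF_mono hsub hcl
  have hTg : T.erase w ⊆ gr M := (Finset.erase_subset _ _).trans (hTG.trans (mem_flatsQ.1 hG).1)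
  have hins : rkN M (insert w (T.erase w)) ≤ rkN M (T.erase w) := rkN_insert_le_of_mem_clF hTg hwcl
  rw [Finset.insert_erase (Finset.mem_sdiff.1 hw).1] at hins
  omega

/-- **`L1 T` is the sum of the BASE requests** over the points `w ∈ Q ∖ K` whose face of `T` is thin. -/
theorem L1_eq_sum_base_req (hG : G ∈ flatsQ M (5 + 1)) (hd : (gr M \ G).card = 2) (hk : kColoops M G = 1)
    {B : Finset α} (hB : B ∈ thinMembers M 5 G) {z : α} (hz : z ∈ G \ clF M B) {T : Finset α}
    (hT : T ∈ tgtSets M 5 G B z) :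
    L1 M 5 G T = ∑ w ∈ (insert z B \ coloops M G).filter (fun w => faceOk M G T w),
      req M 5 ((insert z B).erase w) := by
  rw [L1_eq_sum_req_faces hG hd]
  have hQT : insert z B ⊆ T := (mem_tgtSets.1 hT).2.1
  have hset : (T \ coloops M G).filter (fun w => faceOk M G T w) =
      (insert z B \ coloops M G).filter (fun w => faceOk M G T w) := by
    ext w
    rw [Finset.mem_filter, Finset.mem_filter, Finset.mem_sdiff, Finset.mem_sdiff]
    constructor
    · rintro ⟨⟨hwT, hwK⟩, hok⟩
      exact ⟨⟨(faceOk_base_of_faceOk hG hd hk hB hz hT (Finset.mem_sdiff.2 ⟨hwT, hwK⟩) hok).1, hwK⟩, hok⟩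
    · rintro ⟨⟨hwQ, hwK⟩, hok⟩
      exact ⟨⟨hQT hwQ, hwK⟩, hok⟩
  rw [hset]
  apply Finset.sum_congr rfl
  intro w hw
  rw [Finset.mem_filter, Finset.mem_sdiff] at hw
  have := (faceOk_base_of_faceOk hG hd hk hB hz hT (Finset.mem_sdiff.2 ⟨hQT hw.1.1, hw.1.2⟩) hw.2).2.2
  unfold req
  rw [this]

/-- **`L1 T ≤ Σ r_w` over the thin faces of `Q` at the coloops of `T ∖ K`** (the effective coloops of the target). -/
theorem L1_le_sum_base_req_coloops (hG : G ∈ flatsQ M (5 + 1)) (hd : (gr M \ G).card = 2)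
    (hk : kColoops M G = 1) {B : Finset α} (hB : B ∈ thinMembers M 5 G) {z : α} (hz : z ∈ G \ clF M B)
    {T : Finset α} (hT : T ∈ tgtSets M 5 G B z) :
    L1 M 5 G T ≤ ∑ w ∈ (insert z B \ coloops M G).filter
      (fun w => faceOk M G (insert z B) w ∧ w ∈ coloops M (T \ coloops M G)), req M 5 ((insert z B).erase w) := by
  rw [L1_eq_sum_base_req hG hd hk hB hz hT]
  apply Finset.sum_le_sum_of_subset_of_nonneg
  · intro w hw
    rw [Finset.mem_filter, Finset.mem_sdiff] at hw
    rw [Finset.mem_filter, Finset.mem_sdiff]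
    have hQT : insert z B ⊆ T := (mem_tgtSets.1 hT).2.1
    have hTG : T ⊆ G := subset_G_of_mem_shadowAt (mem_tgtSets.1 hT).1
    have hwT : w ∈ T \ coloops M G := Finset.mem_sdiff.2 ⟨hQT hw.1.1, hw.1.2⟩
    refine ⟨hw.1, (faceOk_base_of_faceOk hG hd hk hB hz hT hwT hw.2).2.1, ?_⟩
    exact mem_coloops_sdiff_of_faceOk hG hTG (rkN_eq_of_mem_shadowAt (mem_tgtSets.1 hT).1) hwT hw.2
  · intro w _ _
    exact req_nonneg _ _

end PercRepro.Shadow
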